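import Summits.AtomisticToContinuum.HydrodynamicLimit.Theorems.ImplosionDichotomyPolynomialCompressionEnergyShell
import Literature.Analysis.FunctionSpaces.TorusCalculusProofs

/-!
# Energy shell from an INTEGRATED rate inequality

Helper file for the line `log-lipschitz-budget` of the crux `ImplosionDichotomy.PolynomialCompression`
(stmt-AtomisticToContinuum-12587), stub `stub_logBudgetShadowing` (level-3 estimate): variant of
`torus_energy_le_of_balance` in which the hypothesis is the integrated inequality
`∫ ∂ₜe(t,·) ≤ Λ(t) ∫ e(t,·) + G(t) √(∫ e(t,·))` (the level-3 pairing contains `L⁴`-terms that are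
only bounded after integration over `𝕋³`).
-/

noncomputable section

namespace Summit.AtomisticToContinuum.HydrodynamicLimit.Theorems

open Set MeasureTheory
open Literature.MathematicalPhysics.KineticTheory Literature.Analysis.FunctionSpaces

/-- **Energy shell, integrated form.** Let `e ≥ 0` be a jointly smooth scalar field on `[0, T) × 𝕋³`
and `Λ, G ≥ 0` continuous on `[0, T)` with `∫ ∂ₜe(t, x) dx ≤ Λ(t) E(t) + G(t) √E(t)`,
`E(t) = ∫ e(t, x) dx`, for every `t ∈ [0, T)` (`∂ₜ` the one-sided time derivative within `[0, T)`).
Then `√E(t) ≤ exp(½ ∫₀ᵗ Λ) (√E(0) + ½ ∫₀ᵗ G)` on `[0, T)`: `E' = ∫ ∂ₜe`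
(`Torus.IsSmoothSpaceTimeOn.hasDerivWithinAt_integral`), the regularised root `√(E + ε²)` has right
derivative `≤ (Λ/2) √(E + ε²) + G/2`, Grönwall (`le_exp_integral_mul_of_deriv_right_le`), `ε → 0`.
[folklore] -/
theorem torus_energy_le_of_integral_rate :
    ∀ {T : ℝ} {e : ℝ → T3 → ℝ} {Λ G : ℝ → ℝ},
      Torus.IsSmoothSpaceTimeOn (Ico 0 T) e → (∀ t ∈ Ico 0 T, ∀ x, 0 ≤ e t x) →
      ContinuousOn Λ (Ico 0 T) → ContinuousOn G (Ico 0 T) →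
      (∀ t ∈ Ico 0 T, 0 ≤ Λ t) → (∀ t ∈ Ico 0 T, 0 ≤ G t) →
      (∀ t ∈ Ico 0 T, ∫ x, Torus.timeDerivWithin (Ico 0 T) e t x ≤
          Λ t * (∫ x, e t x) + G t * Real.sqrt (∫ x, e t x)) →
      ∀ t ∈ Ico 0 T, Real.sqrt (∫ x, e t x) ≤
        Real.exp ((∫ s in (0:ℝ)..t, Λ s) / 2) *
          (Real.sqrt (∫ x, e 0 x) + (∫ s in (0:ℝ)..t, G s) / 2) := by
  -- adapted from `torus_energy_le_of_balance` (file `…EnergyShell`): the divergence step is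
  -- replaced by the integrated hypothesis.
  intro T e Λ G he hnonneg hΛ hG hΛ0 hG0 hrate t ht
  have h0T : (0 : ℝ) ∈ Ico 0 T := ⟨le_rfl, ht.1.trans_lt ht.2⟩
  have hIcc : Icc 0 t ⊆ Ico 0 T := Icc_subset_Ico_right ht.2
  -- the total energy, its one-sided derivative, and the differential inequality
  set E : ℝ → ℝ := fun s => ∫ x, e s x with hE
  set E' : ℝ → ℝ := fun s => ∫ x, Torus.timeDerivWithin (Ico 0 T) e s x with hE'
  have hderiv : ∀ s ∈ Ico 0 T, HasDerivWithinAt E (E' s) (Ico 0 T) s :=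
    fun s hs => he.hasDerivWithinAt_integral (convex_Ico 0 T) hs
  have hEnonneg : ∀ s ∈ Ico 0 T, 0 ≤ E s := fun s hs => integral_nonneg fun x => hnonneg s hs x
  have hle : ∀ s ∈ Ico 0 T, E' s ≤ Λ s * E s + G s * Real.sqrt (E s) := fun s hs => hrate s hs
  -- reduction to an `ε`-regularised bound
  set a : ℝ := (∫ s in (0:ℝ)..t, Λ s) / 2 with ha
  set b : ℝ := (∫ s in (0:ℝ)..t, G s) / 2 with hb
  suffices key : ∀ ε : ℝ, 0 < ε → Real.sqrt (E t) ≤ Real.exp a * (Real.sqrt (E 0) + ε + b) by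
    refine le_of_forall_pos_le_add fun δ hδ => ?_
    have hexp : Real.exp a ≠ 0 := (Real.exp_pos a).ne'
    calc Real.sqrt (E t) ≤ Real.exp a * (Real.sqrt (E 0) + δ / Real.exp a + b) :=
          key (δ / Real.exp a) (div_pos hδ (Real.exp_pos a))
      _ = Real.exp a * (Real.sqrt (E 0) + b) + δ := by field_simp; ring
  intro ε hε
  -- the regularised root `F = √(E + ε²)` and its one-sided derivative
  have hpos : ∀ s ∈ Ico 0 T, 0 < E s + ε ^ 2 := fun s hs =>
    add_pos_of_nonneg_of_pos (hEnonneg s hs) (pow_pos hε 2)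
  set F : ℝ → ℝ := fun s => Real.sqrt (E s + ε ^ 2) with hF
  set F' : ℝ → ℝ := fun s => E' s / (2 * Real.sqrt (E s + ε ^ 2)) with hF'
  have hFderiv : ∀ s ∈ Ico 0 T, HasDerivWithinAt F (F' s) (Ico 0 T) s := fun s hs =>
    ((hderiv s hs).add_const (ε ^ 2)).sqrt (hpos s hs).ne'
  have hFcont : ContinuousOn F (Icc 0 t) := fun s hs =>
    ((hFderiv s (hIcc hs)).continuousWithinAt).mono hIcc
  have hFright : ∀ s ∈ Ico 0 t, HasDerivWithinAt F (F' s) (Ici s) s := by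
    intro s hs
    have hsT : s ∈ Ico 0 T := ⟨hs.1, hs.2.trans ht.2⟩
    exact (hFderiv s hsT).mono_of_mem_nhdsWithin
      (Filter.mem_of_superset (Ico_mem_nhdsGE hsT.2) (Ico_subset_Ico_left hsT.1))
  -- the linear differential inequality `F' ≤ (Λ/2) F + G/2`
  have hFbound : ∀ s ∈ Ico 0 t, F' s ≤ Λ s / 2 * F s + G s / 2 := by
    intro s hs
    have hsT : s ∈ Ico 0 T := ⟨hs.1, hs.2.trans ht.2⟩
    have hFs : 0 < F s := Real.sqrt_pos.2 (hpos s hsT)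
    have hF2 : F s ^ 2 = E s + ε ^ 2 := Real.sq_sqrt (hpos s hsT).le
    have hEF : E s ≤ F s ^ 2 := by rw [hF2]; nlinarith
    have hsqEF : Real.sqrt (E s) ≤ F s := Real.sqrt_le_sqrt (by nlinarith)
    have h1 : E' s ≤ Λ s * F s ^ 2 + G s * F s :=
      (hle s hsT).trans (add_le_add (mul_le_mul_of_nonneg_left hEF (hΛ0 s hsT))
        (mul_le_mul_of_nonneg_left hsqEF (hG0 s hsT)))
    have h2 : F' s = E' s / (2 * F s) := rfl
    rw [h2, div_le_iff₀ (by positivity)]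
    nlinarith [h1]
  -- Grönwall for `F`
  have hmain : F t ≤ Real.exp (∫ s in (0:ℝ)..t, Λ s / 2) * (F 0 + ∫ s in (0:ℝ)..t, G s / 2) :=
    le_exp_integral_mul_of_deriv_right_le (K := fun s => Λ s / 2) (g := fun s => G s / 2) ht.1
      hFcont hFright ((hΛ.mono hIcc).div_const 2) ((hG.mono hIcc).div_const 2)
      (fun s hs => div_nonneg (hΛ0 s (hIcc hs)) zero_le_two)
      (fun s hs => div_nonneg (hG0 s (hIcc hs)) zero_le_two) hFbound
  rw [intervalIntegral.integral_div, intervalIntegral.integral_div] at hmain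
  -- `ε`-bookkeeping: `√E(t) ≤ F t`, `F 0 ≤ √E(0) + ε`
  have hEt : Real.sqrt (E t) ≤ F t := Real.sqrt_le_sqrt (by nlinarith)
  have hF0 : F 0 ≤ Real.sqrt (E 0) + ε := by
    refine Real.sqrt_le_iff.2 ⟨by positivity, ?_⟩
    nlinarith [Real.sq_sqrt (hEnonneg 0 h0T), Real.sqrt_nonneg (E 0), hε.le]
  calc Real.sqrt (E t) ≤ F t := hEt
    _ ≤ Real.exp a * (F 0 + b) := hmain
    _ ≤ Real.exp a * (Real.sqrt (E 0) + ε + b) :=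
        mul_le_mul_of_nonneg_left (by linarith) (Real.exp_pos a).le

end Summit.AtomisticToContinuum.HydrodynamicLimit.Theorems

end
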